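import Literature.NumberTheory.Transcendental.ProjectiveSpace
import HarnessLib

/-!
# Projective space `ℙⁿ(𝕜)` is second countable (proof file)

Sibling proof file of `Literature/NumberTheory/Transcendental/ProjectiveSpace.lean`. That file
equips Mathlib's projectivization `ℙ 𝕜 W` with the quotient topology along
`π = (v ↦ [v]) : {v // v ≠ 0} → ℙ 𝕜 W`, proves that `π` is an open quotient map
(`Projectivization.isQuotientMap_mk`, `Projectivization.isOpenMap_mk`), and vendors as a *named
fact* `Literature.secondCountableTopology_projectivization 𝕜 n` the statement that
`ℙⁿ(𝕜) = ℙ 𝕜 (Fin (n + 1) → 𝕜)` is second countable whenever the nontrivially normed field `𝕜`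
is. This file **discharges that fact** (`Literature.NumberTheory.Transcendental.secondCountableTopology_projectivization_holds`) from
Mathlib and the sibling file alone.

The sources assert second countability as part of "`ℙⁿ` is a (compact) complex manifold", without
a separate argument: Griffiths–Harris, Ch. 0 §2, p. 15; Huybrechts, *Complex Geometry*, §2.1,
pp. 56–57 ("`ℙⁿ` is endowed with the quotient topology via
`π : ℂⁿ⁺¹ ∖ {0} → (ℂⁿ⁺¹ ∖ {0})/ℂ* = ℙⁿ`"; a complex manifold is in particular a differentiable
manifold, whose topology "admits a countable basis", Appendix A, Definition A.0.1 (ii), p. 281).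
The argument formalised here: `π` is an *open* quotient map, and an open quotient map carries a
countable basis of the subspace `{v // v ≠ 0}` of a second-countable space `W` to a countable
basis of the quotient (Mathlib `Topology.IsQuotientMap.secondCountableTopology`). This gives
`Projectivization.secondCountableTopology_of_secondCountableTopology` for every second-countable
topological module `W` with continuous homotheties over a division ring; for
`W = 𝕜ⁿ⁺¹ = Fin (n + 1) → 𝕜` with `𝕜` second countable, `W` is second countable as a finite
product, which is the named fact.

## Main statements

* `Projectivization.secondCountableTopology_of_secondCountableTopology` — `ℙ 𝕜 W` is second
  countable for a second-countable topological module `W`.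
* `Literature.NumberTheory.Transcendental.secondCountableTopology_projectivization_holds` — the named fact
  `Literature.secondCountableTopology_projectivization 𝕜 n` holds:
  `SecondCountableTopology (ℙ 𝕜 (Fin (n + 1) → 𝕜))` whenever `SecondCountableTopology 𝕜`.

## References

* P. Griffiths, J. Harris, *Principles of Algebraic Geometry*, Wiley (1978), Ch. 0 §2, p. 15.
  [GriffithsHarrisPrinciples1978]
* D. Huybrechts, *Complex Geometry. An Introduction*, Universitext, Springer (2005), §2.1
  pp. 56–57 (Projective space) and Appendix A, Definition A.0.1 (p. 281). [HuybrechtsCG2005]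
-/

noncomputable section

open scoped LinearAlgebra.Projectivization
open Set Function Topology

namespace Projectivization

section SecondCountable

variable {𝕜 : Type*} [DivisionRing 𝕜] {W : Type*} [AddCommGroup W] [Module 𝕜 W]
  [TopologicalSpace W] [ContinuousConstSMul 𝕜 W]

/-- The projectivization `ℙ 𝕜 W` of a *second-countable* topological module `W` with continuous
homotheties `v ↦ a • v` is second countable: it is the image of the second-countable subspace
`{v // v ≠ 0}` of `W` under the open quotient map `v ↦ [v]`, and open quotient maps send countable
bases to countable bases.
[cite: HuybrechtsCG2005, §2.1 pp. 56–57 (quotient topology on `ℙⁿ`), Definition A.0.1 (ii) p. 281]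
[cite: GriffithsHarrisPrinciples1978, Ch. 0 §2 p. 15] -/
theorem secondCountableTopology_of_secondCountableTopology [SecondCountableTopology W] :
    SecondCountableTopology (ℙ 𝕜 W) :=
  haveI : SecondCountableTopology {v : W // v ≠ 0} :=
    TopologicalSpace.Subtype.secondCountableTopology {v : W | v ≠ 0}
  isQuotientMap_mk.secondCountableTopology isOpenMap_mk

end SecondCountable

end Projectivization

namespace Literature.NumberTheory.Transcendental

/-- **Discharge of `Literature.NumberTheory.Transcendental.secondCountableTopology_projectivization`.** Projective space `ℙⁿ(𝕜)` over
a second-countable nontrivially normed field `𝕜` is second countable (`𝕜ⁿ⁺¹` is then second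
countable as a finite product, and
`Projectivization.secondCountableTopology_of_secondCountableTopology` applies). Consumers holding
`(h : secondCountableTopology_projectivization 𝕜 n)` are fed this theorem.
[cite: GriffithsHarrisPrinciples1978, Ch. 0 §2 p. 15]
[cite: HuybrechtsCG2005, §2.1 pp. 56–57 with Definition A.0.1 (ii) p. 281] -/
theorem secondCountableTopology_projectivization_holds (𝕜 : Type*) [NontriviallyNormedField 𝕜]
    (n : ℕ) : secondCountableTopology_projectivization 𝕜 n := by
  intro _
  exact Projectivization.secondCountableTopology_of_secondCountableTopology

end Literature.NumberTheory.Transcendental
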